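import Literature.Probability.LatticeModels.CoarseCellMixingDefectsDecay
import Literature.Probability.LatticeModels.CoarseCellMixingDefectsRoot
import HarnessLib

/-!
# Coarse-cell mixing with defects: annealed boundary influence for multi-cell observables
# (block-Markov case) — the van den Berg–Maes / Dobrushin–Shlosman engine with defects

Final ("theorems only") file of the coarse-cell defect series for block-Markov specifications.
Combining the single-cell decay theorem (`influence_decay_markov_defects`), the root step for a
general multi-cell observable (`root_influence_le`) with the sharp entropy bound
(`sum_clusterShapes_le_sharp`, uniform in the number of cells of the observable), and DLR
(`ν = γ_univ(· | ζ)` on a finite site set), we obtain: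

for every window `n ≥ 1` there are `q₀, κₑ > 0` and `C ≥ 0` (depending on `d, n` only) such that
a block-Markov specification on a coarse `d`-torus (`≥ 4n+3` cells per axis) with the good-exterior
finite-size condition `(n, ε)`, `ε · shellCount d n ≤ 3/4`, and the kernel-uniform Peierls bound at
level `q ≤ q₀` has, for every Gibbs measure `ν`, every `[0,1]`-valued measurable observable `f` of
the cells `Δf` and every cell set `Δg` at coarse distance `≥ D` from `Δf`,

`∫ |γ_Λ f(ζ) - ν f| dν(ζ) ≤ C e^{|Δf|} |Δg| e^{-κₑ D}`, `Λ :=` the sites whose cell is not in `Δg`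

(`annealed_influence_markov_defects`; indeed uniformly in `ζ`). This is the block-Markov
instance of the "annealed engine" of the Yang–Mills mass-gap line local-ac-open-certificate
(crux `RobustYangMills`, stub `AnnealedEngineBQLMarkov`), for general dimension `d`.

## References

* J. van den Berg, C. Maes, *Disagreement percolation in the study of Markov fields*,
  Ann. Probab. 22 (1994), §2; R. L. Dobrushin, S. B. Shlosman (1985), §2–3;
  H.-O. Georgii, *Gibbs Measures and Phase Transitions* (2011), §8.2, Rem. 1.24.
-/

noncomputable section

open _root_.MeasureTheory
open scoped ENNReal

namespace Literature.Probability.LatticeModels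

universe u v

variable {d : ℕ} {μc : Fin d → ℕ}

/-- `m ≤ e^m` and `m^2 ≤ 8 e^{m/2}` bookkeeping: `(m + c) m ≤ (1 + c) · 8 e^{m/2}` for `m : ℕ`,
`c ≥ 1`... in the form used below: `(m + c) * m ≤ (1 + c) * (8 * exp (m / 2))`. [folklore] -/
theorem card_quad_le_exp (m : ℕ) {c : ℝ} (hc : 0 ≤ c) :
    ((m : ℝ) + c) * m ≤ (1 + c) * (8 * Real.exp (m / 2)) := by
  have hm : (0 : ℝ) ≤ m := Nat.cast_nonneg m
  have h1 : 1 + (m : ℝ) / 2 + ((m : ℝ) / 2) ^ 2 / 2 ≤ Real.exp (m / 2) :=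
    Real.quadratic_le_exp_of_nonneg (by positivity)
  -- `m^2 ≤ 8 exp(m/2)` and `m ≤ 8 exp(m/2)`
  have h2 : (m : ℝ) ^ 2 ≤ 8 * Real.exp (m / 2) := by nlinarith
  have h3 : (m : ℝ) ≤ 8 * Real.exp (m / 2) := by nlinarith [Real.exp_pos ((m : ℝ) / 2)]
  nlinarith

/-- The prefactor of the near-cluster terms at the root: for `0 ≤ u ≤ 1/2` and `N : ℕ`,
`(N + 3^d) ((1 + u)^N - 1) ≤ 4 (1 + 3^d) e^N`. [folklore] -/
theorem near_prefactor_le (d N : ℕ) {uu : ℝ} (huu0 : 0 ≤ uu) (huu1 : uu ≤ 1 / 2) :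
    ((N : ℝ) + 3 ^ d) * ((1 + uu) ^ N - 1) ≤ 4 * (1 + 3 ^ d) * Real.exp N := by
  -- `(1 + x)^N - 1 ≤ N x (1 + x)^N` for `x ≥ 0` (geometric sum)
  have h1 : (1 + uu) ^ N - 1 ≤ N * uu * (1 + uu) ^ N := by
    have hgeom : (∑ i ∈ Finset.range N, (1 + uu) ^ i) * uu = (1 + uu) ^ N - 1 := by
      have := geom_sum_mul (1 + uu) N
      rwa [add_sub_cancel_left] at this
    rw [← hgeom]
    have h1 : ∑ i ∈ Finset.range N, (1 + uu) ^ i ≤ ∑ _i ∈ Finset.range N, (1 + uu) ^ N :=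
      Finset.sum_le_sum fun i hi =>
        pow_le_pow_right₀ (by linarith) (Finset.mem_range.1 hi).le
    rw [Finset.sum_const, Finset.card_range, nsmul_eq_mul] at h1
    calc (∑ i ∈ Finset.range N, (1 + uu) ^ i) * uu ≤ (N * (1 + uu) ^ N) * uu :=
          mul_le_mul_of_nonneg_right h1 huu0
      _ = N * uu * (1 + uu) ^ N := by ring
  have h2 : (1 + uu) ^ N ≤ Real.exp (N / 2) := by
    calc (1 + uu) ^ N ≤ (Real.exp (1 / 2)) ^ N := by
          refine pow_le_pow_left₀ (by positivity) ?_ N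
          have := Real.add_one_le_exp (1 / 2 : ℝ); linarith
      _ = Real.exp (N / 2) := by rw [← Real.exp_nat_mul]; ring_nf
  have h3 : ((N : ℝ) + 3 ^ d) * N ≤ (1 + 3 ^ d) * (8 * Real.exp (N / 2)) :=
    card_quad_le_exp N (by positivity)
  have hexp2 : Real.exp ((N : ℝ) / 2) * Real.exp (N / 2) = Real.exp N := by
    rw [← Real.exp_add]; ring_nf
  have hNd : (0 : ℝ) ≤ (N : ℝ) + 3 ^ d := by positivity
  calc ((N : ℝ) + 3 ^ d) * ((1 + uu) ^ N - 1)
      ≤ ((N : ℝ) + 3 ^ d) * (N * uu * (1 + uu) ^ N) := mul_le_mul_of_nonneg_left h1 hNd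
    _ = (((N : ℝ) + 3 ^ d) * N) * uu * (1 + uu) ^ N := by ring
    _ ≤ ((1 + 3 ^ d) * (8 * Real.exp (N / 2))) * (1 / 2) * Real.exp (N / 2) := by
        refine mul_le_mul (mul_le_mul h3 huu1 huu0 (by positivity)) h2 (by positivity)
          (by positivity)
    _ = 4 * (1 + 3 ^ d) * Real.exp N := by rw [← hexp2]; ring

/-- **The near-cluster terms at the root, summed** (entropy bookkeeping): if every cell of
`Δf ∪ N₁(K)` has `δ ≤ A t^{|K|}` for each nonempty cluster shape `K` in the family, then
`Σ_K 2 q^{|K|} Σ_{ring of K} δ ≤ 8 A (1 + 3^d) e^{|Δf|}` once `8 (3^d+1)^2 q t ≤ 1`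
(`sum_clusterShapes_le_sharp` + `near_prefactor_le`). [folklore] -/
theorem root_nearTerms_le (Δf U : Finset (CoarseIdx μc)) (P : CoarseIdx μc → Prop)
    [DecidablePred P] {q t A : ℝ} (hq : 0 ≤ q) (ht : 0 ≤ t) (hA : 0 ≤ A)
    (hXqt : 8 * ((3 : ℝ) ^ d + 1) ^ 2 * (q * t) ≤ 1) (δ : CoarseIdx μc → ℝ)
    (hδR : ∀ K ∈ (clusterShapes 1 Finset.univ Δf).filter (fun K => K.Nonempty ∧ K ⊆ U),
      ∀ y ∈ (Δf ∪ fatten Finset.univ (∅ ∪ K) 1) \ (∅ ∪ K), δ y ≤ A * t ^ K.card) :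
    ∑ K ∈ (clusterShapes 1 Finset.univ Δf).filter (fun K => K.Nonempty ∧ K ⊆ U),
        2 * q ^ K.card * ∑ y ∈ ((Δf ∪ fatten Finset.univ (∅ ∪ K) 1) \ (∅ ∪ K)).filter P, δ y ≤
      8 * A * (1 + 3 ^ d) * Real.exp (Δf.card) := by
  classical
  set 𝒩 := (clusterShapes 1 Finset.univ Δf).filter (fun K => K.Nonempty ∧ K ⊆ U) with h𝒩def
  set N : ℕ := Δf.card with hN
  have hz : 0 ≤ q * t := mul_nonneg hq ht
  -- the ring has at most `N + 3^d |K|` cells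
  have hRcard : ∀ K ∈ 𝒩, ((((Δf ∪ fatten Finset.univ (∅ ∪ K) 1) \ (∅ ∪ K)).filter P).card : ℝ) ≤
      N + 3 ^ d * K.card := by
    intro K _
    have hsub : ((Δf ∪ fatten Finset.univ (∅ ∪ K) 1) \ (∅ ∪ K)).filter P ⊆
        Δf ∪ fatten Finset.univ K 1 := by
      intro y hy
      obtain ⟨hy1, -⟩ := Finset.mem_filter.1 hy
      obtain ⟨hy2, -⟩ := Finset.mem_sdiff.1 hy1
      rcases Finset.mem_union.1 hy2 with hyf | hyfat
      · exact Finset.mem_union_left _ hyf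
      · obtain ⟨-, k, hk, hky⟩ := mem_fatten.1 hyfat
        rcases Finset.mem_union.1 hk with h | hkK
        · exact absurd h (Finset.notMem_empty k)
        · exact Finset.mem_union_right _ (mem_fatten.2 ⟨Finset.mem_univ _, k, hkK, hky⟩)
    have h1 := (Finset.card_le_card hsub).trans (Finset.card_union_le _ _)
    have h2 := card_fatten_le (Finset.univ : Finset (CoarseIdx μc)) K 1
    have h4 : (((Δf ∪ fatten Finset.univ (∅ ∪ K) 1) \ (∅ ∪ K)).filter P).card ≤ N + 3 ^ d * K.card := by
      have : (2 * 1 + 1) ^ d * K.card = 3 ^ d * K.card := by norm_num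
      omega
    exact_mod_cast h4
  have hterm : ∀ K ∈ 𝒩, 2 * q ^ K.card * ∑ y ∈ ((Δf ∪ fatten Finset.univ (∅ ∪ K) 1) \ (∅ ∪ K)).filter P, δ y ≤
      2 * A * ((q * t) ^ K.card * (N + 3 ^ d * K.card)) := by
    intro K hK
    have h0 : ∀ y ∈ ((Δf ∪ fatten Finset.univ (∅ ∪ K) 1) \ (∅ ∪ K)).filter P, δ y ≤ A * t ^ K.card :=
      fun y hy => hδR K hK y (Finset.mem_filter.1 hy).1
    have h1 : ∑ y ∈ ((Δf ∪ fatten Finset.univ (∅ ∪ K) 1) \ (∅ ∪ K)).filter P, δ y ≤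
        (((Δf ∪ fatten Finset.univ (∅ ∪ K) 1) \ (∅ ∪ K)).filter P).card * (A * t ^ K.card) := by
      have := Finset.sum_le_sum h0
      rwa [Finset.sum_const, nsmul_eq_mul] at this
    have h2 : ∑ y ∈ ((Δf ∪ fatten Finset.univ (∅ ∪ K) 1) \ (∅ ∪ K)).filter P, δ y ≤
        (N + 3 ^ d * K.card) * (A * t ^ K.card) :=
      h1.trans (mul_le_mul_of_nonneg_right (hRcard K hK) (by positivity))
    calc 2 * q ^ K.card * ∑ y ∈ ((Δf ∪ fatten Finset.univ (∅ ∪ K) 1) \ (∅ ∪ K)).filter P, δ y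
        ≤ 2 * q ^ K.card * ((N + 3 ^ d * K.card) * (A * t ^ K.card)) :=
          mul_le_mul_of_nonneg_left h2 (by positivity)
      _ = 2 * A * ((q * t) ^ K.card * (N + 3 ^ d * K.card)) := by rw [mul_pow]; ring
  refine (Finset.sum_le_sum hterm).trans ?_
  rw [← Finset.mul_sum]
  have hX0 : 0 ≤ ((3 : ℝ) ^ d + 1) ^ 2 * (q * t) := by positivity
  have hXz : 4 * ((3 : ℝ) ^ d + 1) ^ 2 * (q * t) ≤ 1 := by linarith
  have hsum := sum_clusterShapes_le_sharp Δf hz (Nat.cast_nonneg N) (by positivity : (0 : ℝ) ≤ 3 ^ d)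
    hXz
  have hsub : 𝒩 ⊆ (clusterShapes 1 Finset.univ Δf).filter (fun K => K.Nonempty) := by
    intro K hK
    obtain ⟨h1, h2, -⟩ := Finset.mem_filter.1 hK
    exact Finset.mem_filter.2 ⟨h1, h2⟩
  have hnn : ∀ K : Finset (CoarseIdx μc), 0 ≤ (q * t) ^ K.card * ((N : ℝ) + 3 ^ d * K.card) :=
    fun K => mul_nonneg (pow_nonneg hz _)
      (add_nonneg (Nat.cast_nonneg _) (mul_nonneg (pow_nonneg (by norm_num) _) (Nat.cast_nonneg _)))
  have hle := Finset.sum_le_sum_of_subset_of_nonneg hsub (f := fun K =>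
    (q * t) ^ K.card * ((N : ℝ) + 3 ^ d * K.card)) (fun K _ _ => hnn K)
  have hX1 : (1 : ℝ) ≤ ((3 : ℝ) ^ d + 1) ^ 2 := one_le_pow₀ (by
    have : (0 : ℝ) ≤ (3 : ℝ) ^ d := by positivity
    linarith)
  have huu0 : 0 ≤ 4 * (q * t) := by positivity
  have huu1 : 4 * (q * t) ≤ 1 / 2 := by
    have : q * t ≤ ((3 : ℝ) ^ d + 1) ^ 2 * (q * t) := le_mul_of_one_le_left hz hX1
    linarith
  have hkey := near_prefactor_le d N huu0 huu1
  have hfac : 0 ≤ 2 * A := by positivity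
  calc 2 * A * ∑ K ∈ 𝒩, (q * t) ^ K.card * (N + 3 ^ d * K.card)
      ≤ 2 * A * ((N + 3 ^ d) * ((1 + 4 * (q * t)) ^ N - 1)) :=
        mul_le_mul_of_nonneg_left (hle.trans hsum) hfac
    _ ≤ 2 * A * (4 * (1 + 3 ^ d) * Real.exp N) := mul_le_mul_of_nonneg_left hkey hfac
    _ = 8 * A * (1 + 3 ^ d) * Real.exp N := by ring

/-- **The distance exponent** `Dg y = dist(y, Δg)` (or `D` if `Δg = ∅`) and its two monotonicity
facts used at the root: cells of `Δf` have `θ^{Dg} ≤ θ^D`, and cells of `Δf ∪ N₁(K)` for a cluster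
shape `K` have `θ^{Dg} ≤ θ^D t^{|K|}` (`t = θ⁻¹`; a shape of `k` cells reaches at most `k` cells away
from `Δf`). [folklore] -/
theorem exists_distExponent (Δf Δg : Finset (CoarseIdx μc)) {D : ℕ}
    (hfar : ∀ x ∈ Δf, ∀ y ∈ Δg, D ≤ cdist x y) {θ t : ℝ} (hθ : 0 < θ) (hθ1 : θ ≤ 1)
    (ht : t = θ⁻¹) :
    ∃ Dg : CoarseIdx μc → ℕ, (∀ y, ∀ g ∈ Δg, Dg y ≤ cdist y g) ∧
      (∀ y ∈ Δf, θ ^ Dg y ≤ θ ^ D) ∧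
      ∀ K ∈ clusterShapes 1 Finset.univ Δf, ∀ y ∈ (Δf ∪ fatten Finset.univ (∅ ∪ K) 1) \ (∅ ∪ K),
        θ ^ Dg y ≤ θ ^ D * t ^ K.card := by
  classical
  refine ⟨fun y => if h : Δg.Nonempty then Δg.inf' h (fun g => cdist y g) else D, ?_, ?_, ?_⟩
  · intro y g hg
    have hne : Δg.Nonempty := ⟨g, hg⟩
    simp only [dif_pos hne]
    exact Finset.inf'_le (fun g => cdist y g) hg
  · intro y hy
    refine pow_le_pow_of_le_one hθ.le hθ1 ?_
    split_ifs with h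
    · exact Finset.le_inf' h _ (fun g hg => hfar y hy g hg)
    · exact le_rfl
  · intro K hKsh y hy1
    have hKshape := (mem_clusterShapes.1 hKsh).2
    obtain ⟨hy2, -⟩ := Finset.mem_sdiff.1 hy1
    have hdist : ∀ g ∈ Δg, D - K.card ≤ cdist y g := by
      intro g hg
      rcases Finset.mem_union.1 hy2 with hyf | hyfat
      · have := hfar y hyf g hg; omega
      · obtain ⟨-, k, hk, hky⟩ := mem_fatten.1 hyfat
        rcases Finset.mem_union.1 hk with h | hkK
        · exact absurd h (Finset.notMem_empty k)
        · obtain ⟨s', hs', -, hs'k⟩ := hKshape.exists_seed_cdist_le hkK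
          have h1 := hfar s' hs' g hg
          have h2 : cdist s' g ≤ cdist s' y + cdist y g := cdist_triangle _ _ _
          have h3 : cdist s' y ≤ cdist s' k + cdist k y := cdist_triangle _ _ _
          have h4 : 1 ≤ K.card := Finset.card_pos.2 ⟨k, hkK⟩
          rw [one_mul] at hs'k
          omega
    have hm : D - K.card ≤ (if h : Δg.Nonempty then Δg.inf' h (fun g => cdist y g) else D) := by
      split_ifs with h
      · exact Finset.le_inf' h _ hdist
      · exact Nat.sub_le _ _
    have h1 := pow_le_pow_of_le_one hθ.le hθ1 hm
    have h2 : θ ^ (D - K.card) ≤ θ ^ D * t ^ K.card := by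
      have := pow_tsub_le_mul_inv_pow (D := D) hθ hθ1 (le_refl K.card)
      rwa [← ht] at this
    exact h1.trans h2

/-- **The three root terms, summed**: with `δ ≤ C₀ θ^D` on `Δf` and `δ ≤ C₀ θ^D t^{|K|}` on the
ring of each cluster shape `K`, the right-hand side of `root_influence_le` is at most
`(C₀ + 8 C₀ (1 + 3^d) + 4 t^2) e^{|Δf|} θ^D` (for `(3^d+1)^2 q ≤ θ`, `8 (3^d+1)^2 q t ≤ 1`,
`q ≤ 1`, `D ≥ 2`). [folklore] -/
theorem root_bound_le (Δf U : Finset (CoarseIdx μc)) (P : CoarseIdx μc → Prop) [DecidablePred P]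
    {q t θ C₀ : ℝ} {D : ℕ} (hq : 0 ≤ q) (hq1 : q ≤ 1) (hθ : 0 < θ) (ht : t = θ⁻¹)
    (hC₀ : 0 ≤ C₀) (hXqθ : ((3 : ℝ) ^ d + 1) ^ 2 * q ≤ θ)
    (hXqt : 8 * ((3 : ℝ) ^ d + 1) ^ 2 * (q * t) ≤ 1) (hD : 2 ≤ D)
    (δ : CoarseIdx μc → ℝ) (hδf : ∀ y ∈ Δf, δ y ≤ C₀ * θ ^ D)
    (hδR : ∀ K ∈ (clusterShapes 1 Finset.univ Δf).filter (fun K => K.Nonempty ∧ K ⊆ U),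
      ∀ y ∈ (Δf ∪ fatten Finset.univ (∅ ∪ K) 1) \ (∅ ∪ K), δ y ≤ C₀ * θ ^ D * t ^ K.card) :
    ∑ y ∈ Δf, δ y +
      ∑ K ∈ (clusterShapes 1 Finset.univ Δf).filter (fun K => K.Nonempty ∧ K ⊆ U),
        2 * q ^ K.card * ∑ y ∈ (((Δf ∪ fatten Finset.univ (∅ ∪ K) 1) \ (∅ ∪ K))).filter P, δ y +
      2 * (Δf.card * (2 * q * (((3 : ℝ) ^ d + 1) ^ 2 * q) ^ (D - 2))) ≤
    (C₀ + 8 * C₀ * (1 + 3 ^ d) + 4 * t ^ 2) * Real.exp (Δf.card) * θ ^ D := by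
  have htpos : 0 < t := by rw [ht]; exact inv_pos.2 hθ
  have hθt : θ * t = 1 := by rw [ht]; exact mul_inv_cancel₀ hθ.ne'
  have hθD : 0 ≤ θ ^ D := pow_nonneg hθ.le _
  have hexpN : (Δf.card : ℝ) ≤ Real.exp Δf.card := by
    have := Real.add_one_le_exp (Δf.card : ℝ); linarith
  -- (T1)
  have hT1 : ∑ y ∈ Δf, δ y ≤ C₀ * Real.exp Δf.card * θ ^ D := by
    calc ∑ y ∈ Δf, δ y ≤ ∑ _y ∈ Δf, C₀ * θ ^ D := Finset.sum_le_sum hδf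
      _ = Δf.card * (C₀ * θ ^ D) := by rw [Finset.sum_const, nsmul_eq_mul]
      _ ≤ Real.exp Δf.card * (C₀ * θ ^ D) :=
          mul_le_mul_of_nonneg_right hexpN (mul_nonneg hC₀ hθD)
      _ = C₀ * Real.exp Δf.card * θ ^ D := by ring
  -- (T2)
  have hT2 := root_nearTerms_le Δf U P hq htpos.le (mul_nonneg hC₀ hθD) hXqt δ hδR
  -- (T3) the far term: `2 N 2q x^{D-2} ≤ 4 N θ^{D-2} ≤ 4 e^N t^2 θ^D`
  have hT3 : 2 * (Δf.card * (2 * q * (((3 : ℝ) ^ d + 1) ^ 2 * q) ^ (D - 2))) ≤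
      4 * t ^ 2 * Real.exp Δf.card * θ ^ D := by
    have hx0 : 0 ≤ ((3 : ℝ) ^ d + 1) ^ 2 * q :=
      mul_nonneg (pow_nonneg (add_nonneg (pow_nonneg (by norm_num) _) zero_le_one) _) hq
    have h1 : (((3 : ℝ) ^ d + 1) ^ 2 * q) ^ (D - 2) ≤ θ ^ (D - 2) := pow_le_pow_left₀ hx0 hXqθ _
    have h2 : θ ^ (D - 2) = θ ^ D * t ^ 2 := by
      have e : θ ^ D = θ ^ (D - 2) * θ ^ 2 := by rw [← pow_add, Nat.sub_add_cancel hD]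
      rw [e, mul_assoc, ← mul_pow, hθt, one_pow, mul_one]
    have h3 : (Δf.card : ℝ) * q ≤ Real.exp Δf.card :=
      (mul_le_of_le_one_right (Nat.cast_nonneg _) hq1).trans hexpN
    have h4 : 0 ≤ 4 * ((Δf.card : ℝ) * q) := by positivity
    calc 2 * (Δf.card * (2 * q * (((3 : ℝ) ^ d + 1) ^ 2 * q) ^ (D - 2)))
        = 4 * (Δf.card * q) * (((3 : ℝ) ^ d + 1) ^ 2 * q) ^ (D - 2) := by ring
      _ ≤ 4 * (Δf.card * q) * θ ^ (D - 2) := mul_le_mul_of_nonneg_left h1 h4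
      _ ≤ 4 * Real.exp Δf.card * θ ^ (D - 2) :=
          mul_le_mul_of_nonneg_right (mul_le_mul_of_nonneg_left h3 (by norm_num))
            (pow_nonneg hθ.le _)
      _ = 4 * t ^ 2 * Real.exp Δf.card * θ ^ D := by rw [h2]; ring
  have e : (C₀ + 8 * C₀ * (1 + 3 ^ d) + 4 * t ^ 2) * Real.exp Δf.card * θ ^ D =
      C₀ * Real.exp Δf.card * θ ^ D + 8 * (C₀ * θ ^ D) * (1 + 3 ^ d) * Real.exp Δf.card +
        4 * t ^ 2 * Real.exp Δf.card * θ ^ D := by ring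
  rw [e]; linarith

/-- **Uniform boundary influence on a multi-cell observable (block-Markov case)**, given the
single-cell decay bound as a hypothesis: if every single-cell observable at coarse distance
`≥ D'` from `Δg` has influence `≤ C₀ θ^{D'}` for `Δg`-admissible pairs in every volume, then a
`[0,1]`-valued observable of the cells `Δf` at distance `≥ D ≥ 2` from `Δg` has influence
`≤ (C₀ + 8 C₀ (1 + 3^d) + 4 t^2) e^{|Δf|} θ^D` between ANY two boundary conditions on the volume
of sites whose cell is not in `Δg` (`t = θ⁻¹`; `q` below the sharp-entropy threshold
`8 (3^d+1)^2 q t ≤ 1`). [folklore] -/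
theorem uniform_influence_multiCell {V : Type u} {S : Type v} [MeasurableSpace S] [Fintype V]
    [DecidableEq V] {cell : V → CoarseIdx μc}
    {γ : Specification V S} (hγ : IsSpecification γ) {good : CoarseIdx μc → Set (V → S)}
    (hgl : ∀ (c : CoarseIdx μc) (σ τ : V → S), (∀ v, cell v = c → σ v = τ v) →
      (σ ∈ good c ↔ τ ∈ good c))
    (hgm : ∀ c, MeasurableSet (good c)) {r : ℝ} (hBL : HasBlockLeak cell γ 0 r)
    {q θ t C₀ : ℝ} (hq : 0 ≤ q) (hq1 : q ≤ 1) (hθ : 0 < θ) (hθ1 : θ ≤ 1) (ht : t = θ⁻¹)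
    (hC₀ : 0 ≤ C₀) (hXq : ((3 : ℝ) ^ d + 1) ^ 2 * q ≤ 1 / 2) (hXqθ : ((3 : ℝ) ^ d + 1) ^ 2 * q ≤ θ)
    (hXqt : 8 * ((3 : ℝ) ^ d + 1) ^ 2 * (q * t) ≤ 1)
    (hUKP : UniformKernelPeierls cell γ good q) (Δg : Finset (CoarseIdx μc))
    (hdecay : ∀ (D' : ℕ) (x : CoarseIdx μc), (∀ g ∈ Δg, D' ≤ cdist x g) →
      ∀ (Λ' : Finset V), (∀ v w, cell v = cell w → v ∈ Λ' → w ∈ Λ') →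
      ∀ (ζ ζ' : V → S), AdmRegion cell good Δg Λ' ζ ζ' →
      ∀ (g : (V → S) → ℝ), Measurable g → (∀ σ, 0 ≤ g σ ∧ g σ ≤ 1) →
        DependsOn g {v | cell v = x} →
        |∫ σ, g σ ∂(γ Λ' ζ) - ∫ σ, g σ ∂(γ Λ' ζ')| ≤ C₀ * θ ^ D')
    (Δf : Finset (CoarseIdx μc)) {D : ℕ} (hD : 2 ≤ D) (hfar : ∀ x ∈ Δf, ∀ y ∈ Δg, D ≤ cdist x y)
    (ζ ζ' : V → S) (f : (V → S) → ℝ) (hfm : Measurable f) (hf01 : ∀ σ, 0 ≤ f σ ∧ f σ ≤ 1)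
    (hfdep : DependsOn f {v | cell v ∈ Δf}) :
    |∫ σ, f σ ∂(γ (Finset.univ.filter fun v => cell v ∉ Δg) ζ) -
        ∫ σ, f σ ∂(γ (Finset.univ.filter fun v => cell v ∉ Δg) ζ')| ≤
      (C₀ + 8 * C₀ * (1 + 3 ^ d) + 4 * t ^ 2) * Real.exp (Δf.card) * θ ^ D := by
  obtain ⟨Dg, hDg_le, hDgf, hDgR⟩ := exists_distExponent Δf Δg hfar hθ hθ1 ht
  have hδ0 : ∀ y, 0 ≤ C₀ * θ ^ Dg y := fun y => mul_nonneg hC₀ (pow_nonneg hθ.le _)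
  have hR : ∀ (Λ : Finset V), (∀ v w, cell v = cell w → v ∈ Λ → w ∈ Λ) →
      ∀ (y : CoarseIdx μc) (g : (V → S) → ℝ), Measurable g → (∀ σ, 0 ≤ g σ ∧ g σ ≤ 1) →
      DependsOn g {v | cell v = y} →
      ∀ ζ ζ' : V → S, AdmRegion cell good Δg Λ ζ ζ' →
        |∫ σ, g σ ∂(γ Λ ζ) - ∫ σ, g σ ∂(γ Λ ζ')| ≤ C₀ * θ ^ Dg y :=
    fun Λ hΛ y g hgm' hg01 hgdep ζ₁ ζ₁' hadm₁ =>
      hdecay (Dg y) y (hDg_le y) Λ hΛ ζ₁ ζ₁' hadm₁ g hgm' hg01 hgdep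
  refine (root_influence_le hγ hgl hgm hBL hq hXq hUKP Δf Δg hD hfar (δ := fun y => C₀ * θ ^ Dg y)
    hδ0 hR ζ ζ' f hfm hf01 hfdep).trans ?_
  refine root_bound_le Δf _ _ hq hq1 hθ ht hC₀ hXqθ hXqt hD (fun y => C₀ * θ ^ Dg y)
    (fun y hy => mul_le_mul_of_nonneg_left (hDgf y hy) hC₀) ?_
  intro K hK y hy
  have := mul_le_mul_of_nonneg_left (hDgR K (Finset.mem_filter.1 hK).1 y hy) hC₀
  simpa only [mul_assoc] using this

/-- From a uniform two-boundary-condition bound to the annealed bound (DLR once): if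
`|γ_Λ f(ζ) - γ_Λ f(ζ')| ≤ M` for all `ζ, ζ'` then `∫ |γ_Λ f(ζ) - ν f| dν(ζ) ≤ M` for every Gibbs
measure `ν` (`ν f = ∫ γ_Λ f dν`). [cite: Georgii2011, Remark 1.24] -/
theorem integral_abs_sub_le_of_uniform {V : Type u} {S : Type v} [MeasurableSpace S] [Fintype V]
    {γ : Specification V S} (hγ : IsSpecification γ) {ν : Measure (V → S)}
    (hν : IsGibbsMeasure γ ν) (Λ : Finset V) {f : (V → S) → ℝ} (hf : Measurable f)
    (hf01 : ∀ σ, 0 ≤ f σ ∧ f σ ≤ 1) {M : ℝ}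
    (hM : ∀ ζ ζ', |∫ σ, f σ ∂(γ Λ ζ) - ∫ σ, f σ ∂(γ Λ ζ')| ≤ M) :
    ∫ ζ, |∫ σ, f σ ∂(γ Λ ζ) - ∫ σ, f σ ∂ν| ∂ν ≤ M := by
  haveI := hν.isProbabilityMeasure
  set F : (V → S) → ℝ := fun ζ => ∫ σ, f σ ∂(γ Λ ζ) with hF
  have hFm : Measurable F := DobrushinShlosman.measurable_windowAvg' hγ Λ hf
  have hf1 : ∀ σ, |f σ| ≤ 1 := fun σ => by rw [abs_of_nonneg (hf01 σ).1]; exact (hf01 σ).2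
  have hF1 : ∀ ζ, |F ζ| ≤ 1 := DobrushinShlosman.abs_windowAvg_le' hγ Λ hf1
  have hFi : Integrable F ν := DobrushinMetric.integrable_of_abs_le' hFm hF1
  have hνf : ∫ σ, f σ ∂ν = ∫ ζ', F ζ' ∂ν :=
    (hν.integral_integral_eq hγ Λ (DobrushinMetric.integrable_of_abs_le' hf hf1)).symm
  have hinner : ∀ ζ, |F ζ - ∫ σ, f σ ∂ν| ≤ M := by
    intro ζ
    rw [hνf]
    have hsub : ∫ ζ', (F ζ - F ζ') ∂ν = F ζ - ∫ ζ', F ζ' ∂ν := by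
      rw [integral_sub (integrable_const _) hFi, integral_const]
      simp
    rw [← hsub]
    have h := norm_integral_le_of_norm_le_const (μ := ν) (C := M) (f := fun ζ' => F ζ - F ζ')
      (ae_of_all _ fun ζ' => by rw [Real.norm_eq_abs]; exact hM ζ ζ')
    simpa using h
  have h := norm_integral_le_of_norm_le_const (μ := ν) (C := M)
    (f := fun ζ => |F ζ - ∫ σ, f σ ∂ν|)
    (ae_of_all _ fun ζ => by rw [Real.norm_eq_abs, abs_abs]; exact hinner ζ)
  have habs : |∫ ζ, |F ζ - ∫ σ, f σ ∂ν| ∂ν| = ∫ ζ, |F ζ - ∫ σ, f σ ∂ν| ∂ν :=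
    abs_of_nonneg (integral_nonneg fun ζ => abs_nonneg _)
  rw [← habs]
  simpa using h

/-- **Annealed boundary influence with defects, block-Markov case** (the van den Berg–Maes /
Dobrushin–Shlosman engine with rare bad cells): for every dimension `d` and window `n` there are
`q₀, κₑ > 0` and `C ≥ 0` such that every block-Markov specification `γ` on a coarse `d`-torus
(`≥ 4n+3` cells per axis) with the good-exterior finite-size condition `(n, ε)`,
`ε · shellCount d n ≤ 3/4`, and the kernel-uniform Peierls bound at level `q ≤ q₀` satisfies, for
every Gibbs measure `ν`, every `[0,1]`-valued measurable observable `f` of the cells `Δf` and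
every cell set `Δg` at coarse distance `≥ D` from `Δf`,
`∫ |γ_Λ f(ζ) - ν f| dν(ζ) ≤ C e^{|Δf|} |Δg| e^{-κₑ D}` with `Λ :=` the sites whose cell is not in
`Δg` (`influence_decay_markov_defects` + `uniform_influence_multiCell` + DLR; `κₑ = -log θ`).
[cite: BergMaes1994, §2] -/
theorem annealed_influence_markov_defects (d n : ℕ) :
    ∃ q₀ κₑ C : ℝ, 0 < q₀ ∧ 0 < κₑ ∧ 0 ≤ C ∧
    ∀ {μc : Fin d → ℕ} {V : Type u} {S : Type v} [MeasurableSpace S] [Fintype V]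
      (cell : V → CoarseIdx μc) (γ : Specification V S) (good : CoarseIdx μc → Set (V → S))
      (ν : Measure (V → S)) (ε q r : ℝ),
      (∀ i, 4 * n + 3 ≤ μc i + 1) → IsSpecification γ → IsGibbsMeasure γ ν →
      0 ≤ ε → ε * (shellCount d n : ℝ) ≤ 3 / 4 → IsGoodFS cell γ good n ε →
      HasBlockLeak cell γ 0 r → 0 ≤ q → q ≤ q₀ → UniformKernelPeierls cell γ good q →
      ∀ (f : (V → S) → ℝ) (Δf Δg : Finset (CoarseIdx μc)) (D : ℕ),
        Measurable f → (∀ σ, 0 ≤ f σ ∧ f σ ≤ 1) → DependsOn f {v | cell v ∈ Δf} →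
        (∀ x ∈ Δf, ∀ y ∈ Δg, D ≤ cdist x y) →
          ∫ ζ, |∫ σ, f σ ∂(γ (Finset.univ.filter fun v => cell v ∉ Δg) ζ) - ∫ σ, f σ ∂ν| ∂ν ≤
            C * Real.exp (Δf.card) * Δg.card * Real.exp (-(κₑ * D)) := by
  obtain ⟨q₀d, θ, Cd, hq₀d, -, hθ, hθ1, hC1, hdec⟩ := influence_decay_markov_defects.{u, v} d n
  have h3d : (0 : ℝ) ≤ (3 : ℝ) ^ d := pow_nonneg (by norm_num) _
  have hX1 : (1 : ℝ) ≤ ((3 : ℝ) ^ d + 1) ^ 2 := one_le_pow₀ (by linarith)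
  have hX0 : (0 : ℝ) < ((3 : ℝ) ^ d + 1) ^ 2 := by positivity
  have htpos : 0 < θ⁻¹ := inv_pos.2 hθ
  have hθt : θ * θ⁻¹ = 1 := mul_inv_cancel₀ hθ.ne'
  have hC0 : 0 ≤ Cd := zero_le_one.trans hC1
  have hκ : 0 < -Real.log θ := neg_pos.2 (Real.log_neg hθ hθ1)
  refine ⟨min q₀d (θ ^ 2 / (8 * ((3 : ℝ) ^ d + 1) ^ 2)), -Real.log θ,
    Cd + 8 * Cd * (1 + 3 ^ d) + 4 * θ⁻¹ ^ 2 + θ⁻¹, lt_min hq₀d (by positivity), hκ,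
    by positivity, ?_⟩
  intro μc V S _ _ cell γ good ν ε q r hμ hγ hν hε hεs hFS hBL hq hqq₀ hUKP f Δf Δg D hfm hf01
    hfdep hfar
  classical
  haveI := hν.isProbabilityMeasure
  -- the smallness facts on `q`
  have hqd : q ≤ q₀d := hqq₀.trans (min_le_left _ _)
  have hq8 : 8 * ((3 : ℝ) ^ d + 1) ^ 2 * q ≤ θ ^ 2 := by
    have h := hqq₀.trans (min_le_right _ _)
    rw [le_div_iff₀ (by positivity)] at h
    linarith
  have hθ2 : θ ^ 2 ≤ θ := by nlinarith
  have hXq0 : 0 ≤ ((3 : ℝ) ^ d + 1) ^ 2 * q := by positivity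
  have hXqθ : ((3 : ℝ) ^ d + 1) ^ 2 * q ≤ θ := by nlinarith
  have hXq : ((3 : ℝ) ^ d + 1) ^ 2 * q ≤ 1 / 2 := by nlinarith
  have hq1 : q ≤ 1 := by nlinarith
  have hXqt : 8 * ((3 : ℝ) ^ d + 1) ^ 2 * (q * θ⁻¹) ≤ 1 := by
    calc 8 * ((3 : ℝ) ^ d + 1) ^ 2 * (q * θ⁻¹) = 8 * ((3 : ℝ) ^ d + 1) ^ 2 * q * θ⁻¹ := by ring
      _ ≤ θ ^ 2 * θ⁻¹ := mul_le_mul_of_nonneg_right hq8 htpos.le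
      _ = θ * (θ * θ⁻¹) := by ring
      _ ≤ 1 := by rw [hθt, mul_one]; exact hθ1.le
  -- `e^{-κₑ D} = θ^D`
  have hexpD : Real.exp (-(-Real.log θ * D)) = θ ^ D := by
    rw [neg_mul, neg_neg, mul_comm, Real.exp_nat_mul, Real.exp_log hθ]
  rw [hexpD]
  have hexp1 : (1 : ℝ) ≤ Real.exp (Δf.card) := Real.one_le_exp (Nat.cast_nonneg _)
  have hθD : 0 ≤ θ ^ D := pow_nonneg hθ.le _
  set Λ : Finset V := Finset.univ.filter fun v => cell v ∉ Δg with hΛ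
  by_cases hΔg : Δg = ∅
  · -- no conditioning: `Λ = univ`, `γ_univ f (ζ) = ν f`
    subst hΔg
    have hΛu : Λ = Finset.univ := by
      rw [hΛ]; exact Finset.filter_true_of_mem fun v _ => Finset.notMem_empty _
    have h0 : ∀ ζ ζ', |∫ σ, f σ ∂(γ Λ ζ) - ∫ σ, f σ ∂(γ Λ ζ')| ≤ 0 := by
      intro ζ ζ'
      rw [hΛu, ← gibbs_eq_kernel_univ hγ hν ζ, ← gibbs_eq_kernel_univ hγ hν ζ', sub_self, abs_zero]
    refine (integral_abs_sub_le_of_uniform hγ hν Λ hfm hf01 h0).trans ?_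
    simp
  have hg1 : (1 : ℝ) ≤ Δg.card := by
    exact_mod_cast Finset.card_pos.2 (Finset.nonempty_iff_ne_empty.2 hΔg)
  have hbig : θ⁻¹ ≤ (Cd + 8 * Cd * (1 + 3 ^ d) + 4 * θ⁻¹ ^ 2 + θ⁻¹) * Real.exp (Δf.card) *
      Δg.card := by
    have h1 : θ⁻¹ ≤ Cd + 8 * Cd * (1 + 3 ^ d) + 4 * θ⁻¹ ^ 2 + θ⁻¹ := by
      have : 0 ≤ Cd + 8 * Cd * (1 + 3 ^ d) + 4 * θ⁻¹ ^ 2 := by positivity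
      linarith
    have h0 : 0 ≤ Cd + 8 * Cd * (1 + 3 ^ d) + 4 * θ⁻¹ ^ 2 + θ⁻¹ := htpos.le.trans h1
    calc θ⁻¹ ≤ Cd + 8 * Cd * (1 + 3 ^ d) + 4 * θ⁻¹ ^ 2 + θ⁻¹ := h1
      _ = (Cd + 8 * Cd * (1 + 3 ^ d) + 4 * θ⁻¹ ^ 2 + θ⁻¹) * 1 * 1 := by ring
      _ ≤ (Cd + 8 * Cd * (1 + 3 ^ d) + 4 * θ⁻¹ ^ 2 + θ⁻¹) * Real.exp (Δf.card) * Δg.card :=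
          mul_le_mul (mul_le_mul_of_nonneg_left hexp1 h0) hg1 zero_le_one (by positivity)
  by_cases hD2 : D < 2
  · -- short distances: the trivial bound `1 ≤ t θ^D`
    have htriv : ∀ ζ ζ', |∫ σ, f σ ∂(γ Λ ζ) - ∫ σ, f σ ∂(γ Λ ζ')| ≤ 1 := by
      intro ζ ζ'
      haveI := hγ.isProbability Λ ζ
      haveI := hγ.isProbability Λ ζ'
      obtain ⟨h1, h2⟩ := integral_mem_unitInterval (μ := γ Λ ζ) hfm hf01
      obtain ⟨h3, h4⟩ := integral_mem_unitInterval (μ := γ Λ ζ') hfm hf01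
      rw [abs_le]; constructor <;> linarith
    refine (integral_abs_sub_le_of_uniform hγ hν Λ hfm hf01 htriv).trans ?_
    have hθD1 : θ ≤ θ ^ D := by
      have := pow_le_pow_of_le_one hθ.le hθ1.le (show D ≤ 1 by omega)
      rwa [pow_one] at this
    calc (1 : ℝ) = θ⁻¹ * θ := by rw [mul_comm, hθt]
      _ ≤ θ⁻¹ * θ ^ D := mul_le_mul_of_nonneg_left hθD1 htpos.le
      _ ≤ (Cd + 8 * Cd * (1 + 3 ^ d) + 4 * θ⁻¹ ^ 2 + θ⁻¹) * Real.exp (Δf.card) * Δg.card *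
            θ ^ D := mul_le_mul_of_nonneg_right hbig hθD
  · -- `D ≥ 2`: the uniform multi-cell bound, then DLR
    have hD : 2 ≤ D := not_lt.1 hD2
    have hsup : ∀ ζ ζ', |∫ σ, f σ ∂(γ Λ ζ) - ∫ σ, f σ ∂(γ Λ ζ')| ≤
        (Cd + 8 * Cd * (1 + 3 ^ d) + 4 * θ⁻¹ ^ 2) * Real.exp (Δf.card) * θ ^ D :=
      fun ζ ζ' => uniform_influence_multiCell hγ hFS.good_local hFS.good_meas hBL hq hq1 hθ hθ1.le
        rfl hC0 hXq hXqθ hXqt hUKP Δg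
        (fun D' x hx Λ' hΛ' ζ₁ ζ₁' hadm g hgm hg01 hgdep =>
          hdec cell γ good ε q r hμ hγ hFS.good_local hFS.good_meas hε hεs hFS hBL hq hqd hUKP D'
            Δg x hx Λ' hΛ' ζ₁ ζ₁' hadm g hgm hg01 hgdep)
        Δf hD hfar ζ ζ' f hfm hf01 hfdep
    refine (integral_abs_sub_le_of_uniform hγ hν Λ hfm hf01 hsup).trans ?_
    have hA0 : 0 ≤ (Cd + 8 * Cd * (1 + 3 ^ d) + 4 * θ⁻¹ ^ 2) * Real.exp (Δf.card) := by
      positivity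
    have hB0 : 0 ≤ (Cd + 8 * Cd * (1 + 3 ^ d) + 4 * θ⁻¹ ^ 2 + θ⁻¹) * Real.exp (Δf.card) := by
      positivity
    calc (Cd + 8 * Cd * (1 + 3 ^ d) + 4 * θ⁻¹ ^ 2) * Real.exp (Δf.card) * θ ^ D
        ≤ (Cd + 8 * Cd * (1 + 3 ^ d) + 4 * θ⁻¹ ^ 2 + θ⁻¹) * Real.exp (Δf.card) * θ ^ D :=
          mul_le_mul_of_nonneg_right (mul_le_mul_of_nonneg_right (by linarith)
            (zero_le_one.trans hexp1)) hθD
      _ = (Cd + 8 * Cd * (1 + 3 ^ d) + 4 * θ⁻¹ ^ 2 + θ⁻¹) * Real.exp (Δf.card) * 1 * θ ^ D := by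
          rw [mul_one]
      _ ≤ (Cd + 8 * Cd * (1 + 3 ^ d) + 4 * θ⁻¹ ^ 2 + θ⁻¹) * Real.exp (Δf.card) * Δg.card *
            θ ^ D := mul_le_mul_of_nonneg_right (mul_le_mul_of_nonneg_left hg1 hB0) hθD

end Literature.Probability.LatticeModels
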